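import Literature.Computability.Complexity.UmansFPGenSearch
import Literature.Computability.Complexity.UmansFPPredictor
import Literature.Computability.Complexity.MurrayWilliams2018StringComplexity
import Mathlib.LinearAlgebra.Lagrange
import HarnessLib

/-!
# Umans' generator, machine level XIV: evaluating the encoding and the output bits

Literature / circuit complexity — derandomization. The generator of C. Umans, JCSS 67 (2003),
Thm. 14 / Thm. 6 outputs, on the seed `(y, pos)`, the Hadamard bits at `pos` of the `m` symbols
`Ẽ(α y), Ẽ(α² y), …, Ẽ(αᵐ y)` (eq. (7), Lemma 13), where `Ẽ(u) = Σ_j φ(σ⁻ʲ u) • σʲ(β)` (Def. 9,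
sign-corrected) and `φ` is the Lagrange extension of the truth table placed along the positions
`α^{r k}` (§4.1, eq. (2)). This file writes these evaluations as programs on bitmask data and
proves their ALGEBRAIC values (products/sums in `K` and `L = K[z]/(p)`); the identification with
`lde`, `augE`, `qGen`, `binGen` is done where the mathematical objects live (`UmansSetup.lean`).

* `lagEvalL` (`elt_lagEvalL`: the Lagrange basis polynomial of the node `a` on the node set `H`,
  evaluated), `ldeTermL`, `ldeEvalL` (`elt_ldeEvalL`: `Σ_{k : bit k} Π_j ℓ_{pos_k,j}(u_j)`),
  `augEvalL` (`lElt_augEvalL`: `Σ_j φ(u^{q^{d-j}}) · β^{q^j}`), `positionsL` (`positionsL_spec`: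
  the powers of `α^r`), `symbolsL` (`symbolsL_spec`), `genBitsL`, `parseL`;
* the parameter programs `isPrimeB`, `nextPrimeL` (`nextPrimeL_spec`), `clog2L` (`clog2L_spec`), `dBaseL`
  (`dBaseL_spec`), `aOf`, `MOf`, `dOf` (the constant `c₀ = log_h q` is a parameter `c0`);
* **`genCoreL`** (the generator at given parameters) and **`genL`** (with the small-`s` branch).

Everything is proved; no named fact.

## References

* C. Umans, *Pseudo-random generators for all hardnesses*, JCSS 67 (2003), §4.1 eq. (2), §4.2
  Def. 9, §5 Thm. 14 eq. (7), Lemma 13 [Umans2003].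
-/

noncomputable section

namespace Literature.Computability.Complexity

open Polynomial Literature.InformationTheory.Coding
open Literature.InformationTheory.Coding.GF2X CodeFP Finset

namespace UmansFP

/-! ### The Lagrange extension -/

/-- **The Lagrange basis polynomial of the node `a` evaluated at `t`**: `Π_{a' ∈ H, a' ≠ a} (t - a')(a - a')⁻¹`.
[cite: Umans2003, §4.1, eq. (2)] -/
def lagEvalL (c : ℕ × ℕ × ℕ) (Hl : List ℕ) (a t : ℕ) : ℕ :=
  (Hl.filter fun a' => a' != a).foldl (fun acc a' => cmul c acc (cmul c (xorW c.1 t a') (cinv c (xorW c.1 a a')))) 1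

/-- **One term** of the extension: `Π_{j<d} ℓ_{pos_j}(u_j)`. [cite: Umans2003, §4.1, eq. (2)] -/
def ldeTermL (c : ℕ × ℕ × ℕ) (Hl : List ℕ) (pos u : List ℕ) : ℕ :=
  (List.range pos.length).foldl (fun acc j => cmul c acc (lagEvalL c Hl (pos.getD j 0) (u.getD j 0))) 1

/-- **The Lagrange extension of the placed table at `u`**: `Σ_{k : x_k = 1} Π_j ℓ_{pos_{k,j}}(u_j)`.
[cite: Umans2003, §4.1, eq. (2) and Thm. 8] -/
def ldeEvalL (c : ℕ × ℕ × ℕ) (Hl : List ℕ) (posL : List (List ℕ)) (xs : List Bool) (u : List ℕ) : ℕ :=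
  (List.range posL.length).foldl (fun acc k => if xs.getD k false then xorW c.1 acc (ldeTermL c Hl (posL.getD k []) u) else acc) 0

/-- **The augmented encoding at `u`**: `Σ_{j<d} φ(u^{q^{d-j}}) • β^{q^j}` (`q = 2^{logq}`).
[cite: Umans2003, §4.2, Def. 9] -/
def augEvalL (c : ℕ × ℕ × ℕ) (pc : List ℕ) (logq : ℕ) (Hl : List ℕ) (posL : List (List ℕ)) (xs : List Bool) (βu u : List ℕ) : List ℕ :=
  (List.range pc.length).foldl (fun acc j =>
    ladd c.1 acc (lsmul c (ldeEvalL c Hl posL xs (lsqIter c pc u (logq * (pc.length - j)))) (lsqIter c pc βu (logq * j))))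
    (List.replicate pc.length 0)

/-- **The positions** `1, γ, γ², …, γ^{n-1}` (`γ = α^r`). [cite: Umans2003, §4.1 ("location `α^{ri}`")] -/
def positionsL (c : ℕ × ℕ × ℕ) (pc γu : List ℕ) (n : ℕ) : List (List ℕ) :=
  ((List.replicate n ()).foldl (fun st _ => (lmul c pc st.1 γu, st.2 ++ [st.1])) (lone pc.length, ([] : List (List ℕ)))).2

/-- **The symbols** `Ẽ(α y), …, Ẽ(αᵐ y)`. [cite: Umans2003, §5, Thm. 14, eq. (7)] -/
def symbolsL (c : ℕ × ℕ × ℕ) (pc : List ℕ) (logq : ℕ) (Hl : List ℕ) (posL : List (List ℕ)) (xs : List Bool) (βu αu yu : List ℕ) (m : ℕ) :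
    List (List ℕ) :=
  ((List.replicate m ()).foldl (fun st _ =>
    (lmul c pc αu st.1, st.2 ++ [augEvalL c pc logq Hl posL xs βu (lmul c pc αu st.1)])) (yu, ([] : List (List ℕ)))).2

/-- **The output bits**: the Hadamard bit at `yv` of the Reed–Solomon symbol at `a` of each symbol.
[cite: Umans2003, Lemma 13 (the code `C`)] -/
def genBitsL (c : ℕ × ℕ × ℕ) (b : ℕ) (symbols : List (List ℕ)) (a yv : ℕ) : List Bool :=
  symbols.map fun sy => hadB b (keval c sy a) yv

/-- **Parsing** `k` blocks of `b` bits into numbers. [folklore] -/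
def parseL (b k : ℕ) (w : List Bool) : List ℕ := (List.range k).map fun i => bitsToNat ((w.drop (i * b)).take b)

/-! ### Parameters -/

/-- Primality by trial division. [folklore] -/
def isPrimeB (p : ℕ) : Bool := decide (2 ≤ p) && (List.range p).all fun k => decide (k < 2) || !(decide (p % k = 0))

/-- The least prime in `[D₀, 2 D₀ + 2]` (`0` if none, which does not happen). [folklore] -/
def nextPrimeL (D₀ : ℕ) : ℕ := (((List.range (2 * D₀ + 3)).filter fun p => decide (D₀ ≤ p) && isPrimeB p).headD 0)

/-- `isPrimeB` is primality. [folklore] -/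
theorem isPrimeB_iff (p : ℕ) : isPrimeB p = true ↔ p.Prime := by
  rw [isPrimeB, Bool.and_eq_true, decide_eq_true_eq, List.all_eq_true, Nat.prime_def_lt]
  simp only [List.mem_range, Bool.or_eq_true, decide_eq_true_eq, Bool.not_eq_true', decide_eq_false_iff_not]
  constructor
  · rintro ⟨h2, h⟩
    refine ⟨h2, fun m hm hdvd => ?_⟩
    rcases h m hm with hlt | hnd
    · interval_cases m
      · exact absurd (Nat.eq_zero_of_zero_dvd hdvd) (by omega)
      · rfl
    · exact absurd (Nat.mod_eq_zero_of_dvd hdvd) hnd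
  · rintro ⟨h2, h⟩
    refine ⟨h2, fun m hm => ?_⟩
    by_cases hlt : m < 2
    · exact Or.inl hlt
    · exact Or.inr fun hmod => by have := h m hm (Nat.dvd_of_mod_eq_zero hmod); omega

/-- **`nextPrimeL D₀` is a prime in `[D₀, 2 D₀ + 2]`** (Bertrand's postulate). [folklore] -/
theorem nextPrimeL_spec (D₀ : ℕ) : (nextPrimeL D₀).Prime ∧ D₀ ≤ nextPrimeL D₀ ∧ nextPrimeL D₀ ≤ 2 * D₀ + 2 := by
  -- a prime exists in the range
  obtain ⟨p, hp, hpD, hp2⟩ : ∃ p, p.Prime ∧ D₀ ≤ p ∧ p ≤ 2 * D₀ + 2 := by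
    rcases Nat.eq_zero_or_pos D₀ with rfl | hpos
    · exact ⟨2, Nat.prime_two, by omega, by omega⟩
    · obtain ⟨p, hp, hlt, hle⟩ := Nat.exists_prime_lt_and_le_two_mul D₀ (by omega)
      exact ⟨p, hp, hlt.le, by omega⟩
  set l := (List.range (2 * D₀ + 3)).filter fun p => decide (D₀ ≤ p) && isPrimeB p with hl
  have hmem : p ∈ l := by
    rw [hl, List.mem_filter, List.mem_range, Bool.and_eq_true, decide_eq_true_eq, isPrimeB_iff]
    exact ⟨by omega, hpD, hp⟩
  have hne : l ≠ [] := List.ne_nil_of_mem hmem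
  have hhead : l.headD 0 ∈ l := by
    cases hl' : l with
    | nil => exact absurd hl' hne
    | cons x xs => exact List.mem_cons_self
  rw [nextPrimeL, ← hl]
  obtain ⟨h1, h2⟩ := List.mem_filter.1 hhead
  rw [Bool.and_eq_true, decide_eq_true_eq, isPrimeB_iff] at h2
  exact ⟨h2.2, h2.1, by have := List.mem_range.1 h1; omega⟩

/-- `⌈log₂ n⌉` by search: the least `k ≤ n` with `n ≤ 2ᵏ`. [folklore] -/
def clog2L (n : ℕ) : ℕ := ((List.range (n + 1)).find? fun k => decide (n ≤ 2 ^ k)).getD 0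

/-- **`clog2L n` is the least `k` with `n ≤ 2ᵏ`.** [folklore] -/
theorem clog2L_spec (n : ℕ) : n ≤ 2 ^ clog2L n ∧ ∀ k, n ≤ 2 ^ k → clog2L n ≤ k := by
  have hsome : ((List.range (n + 1)).find? fun k => decide (n ≤ 2 ^ k)).isSome = true :=
    (List.find?_isSome (p := fun k => decide (n ≤ 2 ^ k))).2 ⟨n, List.mem_range.2 (Nat.lt_succ_self n), by simpa using Nat.lt_two_pow_self.le⟩
  obtain ⟨k₀, hk₀⟩ := Option.isSome_iff_exists.1 hsome
  have hval : clog2L n = k₀ := by rw [clog2L, hk₀, Option.getD_some]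
  rw [hval]
  have h1 := List.find?_some hk₀
  simp only [decide_eq_true_eq] at h1
  refine ⟨h1, fun k hk => ?_⟩
  by_contra hlt
  push Not at hlt
  obtain ⟨-, as, bs, heq, hbefore⟩ := List.find?_eq_some_iff_append.1 hk₀
  -- `k` occurs before `k₀` in `range (n+1)`
  have hkmem : k ∈ as := by
    have hidx : ∀ i, (hi : i < (List.range (n + 1)).length) → (List.range (n + 1))[i] = i := fun i hi => List.getElem_range hi
    have hlen : as.length = k₀ := by
      have h0 := hidx as.length (by rw [heq, List.length_append, List.length_cons]; omega)
      rw [List.getElem_of_eq heq, List.getElem_append_right (le_refl _)] at h0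
      simpa using h0.symm
    have hk' : k < as.length := by rw [hlen]; exact hlt
    have := hidx k (by rw [heq, List.length_append]; omega)
    rw [List.getElem_of_eq heq, List.getElem_append_left hk'] at this
    rw [← this]; exact List.getElem_mem _
  have := hbefore k hkmem
  simp only [hk, decide_true, Bool.not_true, Bool.false_eq_true] at this

/-- The least `e ≤ n` with `n < hᵉ` (`0` if none, which does not happen for `h ≥ 2`). [folklore] -/
def dBaseL (h n : ℕ) : ℕ := ((List.range (n + 1)).find? fun e => decide (n < h ^ e)).getD 0

/-- **`dBaseL h n`** (`h ≥ 2`): `n < h^{dBase}` and `h^{dBase - 1} ≤ n` when `dBase ≥ 1`. [folklore] -/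
theorem dBaseL_spec {h : ℕ} (hh : 2 ≤ h) (n : ℕ) : n < h ^ dBaseL h n ∧ ∀ e, n < h ^ e → dBaseL h n ≤ e := by
  have hsome : ((List.range (n + 1)).find? fun e => decide (n < h ^ e)).isSome = true :=
    (List.find?_isSome (p := fun e => decide (n < h ^ e))).2 ⟨n, List.mem_range.2 (Nat.lt_succ_self n), by
      simpa using Nat.lt_two_pow_self.trans_le (Nat.pow_le_pow_left hh n)⟩
  obtain ⟨k₀, hk₀⟩ := Option.isSome_iff_exists.1 hsome
  have hval : dBaseL h n = k₀ := by rw [dBaseL, hk₀, Option.getD_some]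
  rw [hval]
  have h1 := List.find?_some hk₀
  simp only [decide_eq_true_eq] at h1
  refine ⟨h1, fun k hk => ?_⟩
  by_contra hlt
  push Not at hlt
  obtain ⟨-, as, bs, heq, hbefore⟩ := List.find?_eq_some_iff_append.1 hk₀
  have hkmem : k ∈ as := by
    have hidx : ∀ i, (hi : i < (List.range (n + 1)).length) → (List.range (n + 1))[i] = i := fun i hi => List.getElem_range hi
    have hlen : as.length = k₀ := by
      have h0 := hidx as.length (by rw [heq, List.length_append, List.length_cons]; omega)
      rw [List.getElem_of_eq heq, List.getElem_append_right (le_refl _)] at h0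
      simpa using h0.symm
    have hk' : k < as.length := by rw [hlen]; exact hlt
    have := hidx k (by rw [heq, List.length_append]; omega)
    rw [List.getElem_of_eq heq, List.getElem_append_left hk'] at this
    rw [← this]; exact List.getElem_mem _
  have := hbefore k hkmem
  simp only [hk, decide_true, Bool.not_true, Bool.false_eq_true] at this

/-- `a = ⌈log₂(m + 2)⌉` (`h = 2ᵃ ≥ m + 2`). [cite: Umans2003, §5 (choice of parameters)] -/
def aOf (m : ℕ) : ℕ := clog2L (m + 2)

/-- `M = a c₀ - 1` (`q = 2^{M+1} = h^{c₀}`). [cite: Umans2003, §5 (choice of parameters)] -/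
def MOf (c0 m : ℕ) : ℕ := aOf m * c0 - 1

/-- `d` = the least prime `≥ max (c₀ + 1) e₀`, `e₀` least with `n < h^{e₀}` (`hᵈ > n`, `gcd(c₀, d) = 1`).
[cite: Umans2003, §5 (choice of parameters), Lemma 7] -/
def dOf (c0 n m : ℕ) : ℕ := nextPrimeL (max (c0 + 1) (dBaseL (2 ^ aOf m) n))

/-! ### The generator -/

/-- `q = 2^{M+1}`. [cite: Umans2003, §5] -/
def qOf (M : ℕ) : ℕ := 2 ^ (M + 1)

/-- **The field context** `(W, f, P) = (M + 2, f_M, 2^{M+1})` found by the search of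
`BCHExplicitFP` (budget `min q cap`). [cite: Umans2003, §3] -/
def ctxOf (cap M : ℕ) : ℕ × ℕ × ℕ := (M + 2, irredSearch M (min (qOf M) cap), qOf M)

/-- **The subfield `F_h`** (`h = 2ᵃ`) as the list of `u < q` with `u^h = u`. [cite: Umans2003, §3] -/
def HlOf (cap a M : ℕ) : List ℕ := (List.range (min (qOf M) cap)).filter fun u => cpow (ctxOf cap M) u (min (2 ^ a) cap) == u

/-- **The modulus** `p ∈ F_h[z]`, irreducible of degree `d` over `F_q`. [cite: Umans2003, §3, Lemma 7] -/
def pcOf (cap a M d : ℕ) : List ℕ := findIrredL (ctxOf cap M) cap (min (qOf M) cap) d (HlOf cap a M)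

/-- **The primitive element** `α` of `L = F_q[z]/(p)`. [cite: Umans2003, §4.1] -/
def αOf (cap a M d : ℕ) : List ℕ := findPrimL (ctxOf cap M) cap (min (qOf M) cap) (pcOf cap a M d) (min (qOf M ^ d - 1) cap)

/-- **The normal element** `β`. [cite: Umans2003, §4.2, Def. 9] -/
def βOf (cap a M d : ℕ) : List ℕ := findNormalL (ctxOf cap M) cap (min (qOf M) cap) (pcOf cap a M d) (M + 1)

/-- **The generator `γ = α^r` of `F_{h^d}^×`**, `r = (q^d - 1)/(h^d - 1)`. [cite: Umans2003, §4.1] -/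
def γOf (cap a M d : ℕ) : List ℕ :=
  lpowB (ctxOf cap M) (pcOf cap a M d) (αOf cap a M d) ((qOf M ^ d - 1) / ((2 ^ a) ^ d - 1)) (d * (M + 1) + 1)

/-- **The generator at the parameters `(a, M, d)`** on the table `xs`, the target size `m`, the
seed `seed` (`(d+2)(M+1)` bits read), with enumeration cap `cap` (every unary quantity is capped by
`cap`; the caps are inactive when `q^d ≤ cap`): field setup by the searches of
`UmansFPGenSearch.lean`, then the output bits. [cite: Umans2003, Thm. 14, eq. (7); Lemma 13; Thm. 6] -/
def genCoreL (cap : ℕ) (xs : List Bool) (m : ℕ) (seed : List Bool) (a M d : ℕ) : List Bool :=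
  let c := ctxOf cap M
  let pc := pcOf cap a M d
  let posL := positionsL c pc (γOf cap a M d) xs.length
  let prs := parseL (M + 1) (d + 2) seed
  let syms := symbolsL c pc (M + 1) (HlOf cap a M) posL xs (βOf cap a M d) (αOf cap a M d) (prs.take d) m
  genBitsL c (M + 1) syms (prs.getD d 0) (prs.getD (d + 1) 0)

/-- **Umans' generator as a function of `(Y, s, seed)`** (Murray–Williams' interface): if the seed
is at least as long as the target, output seed bits (they fool everything); else run the core at
the parameters of `s` and `n = |padTable Y|`, with enumeration cap `cap`. [cite: Umans2003, Thm. 6] -/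
def genL (c0 cap : ℕ) (Y : List Bool) (s : ℕ) (seed : List Bool) : List Bool :=
  if s ≤ seed.length then seed.take s
  else genCoreL cap (padTable Y) s seed (aOf s) (MOf c0 s) (dOf c0 (padTable Y).length s)

/-- The exponent of the enumeration cap `N^{capExp}`. [folklore] -/
def capExp : ℕ := 1000

/-- **The generator on Murray–Williams' interface** `(Y, 1ˢ, seed)`, cap `(|Y| + s + |seed| + 2)^{capExp}`.
[cite: Umans2003, Thm. 6; MurrayWilliams2018, Thm. 3.1] -/
def genTop (c0 : ℕ) (Y : List Bool) (s : ℕ) (seed : List Bool) : List Bool :=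
  genL c0 ((Y.length + s + seed.length + 2) ^ capExp) Y s seed

/-! ### Algebraic values of the evaluations -/

section EvalSpec

variable {M : ℕ}

/-- A list product over `range n` as a `Fin n` product. [folklore] -/
theorem prod_map_range_fin {R : Type*} [CommMonoid R] (f : ℕ → R) : ∀ n : ℕ, ((List.range n).map f).prod = ∏ i : Fin n, f i
  | 0 => by simp
  | n + 1 => by rw [List.range_succ, List.map_append, List.prod_append, prod_map_range_fin f n, Fin.prod_univ_castSucc]; simp

/-- A list sum over `range n` as a `Fin n` sum. [folklore] -/
theorem sum_map_range_fin {R : Type*} [AddCommMonoid R] (f : ℕ → R) : ∀ n : ℕ, ((List.range n).map f).sum = ∑ i : Fin n, f i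
  | 0 => by simp
  | n + 1 => by rw [List.range_succ, List.map_append, List.sum_append, sum_map_range_fin f n, Fin.sum_univ_castSucc]; simp

/-- A `cmul`-fold is the product, on reduced data. [folklore] -/
theorem foldl_cmul_spec {ι : Type*} (f : ι → ℕ) (hf : ∀ i, f i < 2 ^ (M + 1)) :
    ∀ (l : List ι) (acc : ℕ), acc < 2 ^ (M + 1) →
      GF2.elt M (l.foldl (fun acc i => cmul (kctx M) acc (f i)) acc) = GF2.elt M acc * (l.map fun i => GF2.elt M (f i)).prod ∧
        l.foldl (fun acc i => cmul (kctx M) acc (f i)) acc < 2 ^ (M + 1)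
  | [], acc, hacc => ⟨by simp, hacc⟩
  | i :: l, acc, hacc => by
    obtain ⟨hm, hmlt⟩ := kmul_spec M hacc (hf i)
    obtain ⟨h1, h2⟩ := foldl_cmul_spec f hf l _ hmlt
    refine ⟨by rw [List.foldl_cons, cmul_kctx, h1, hm, List.map_cons, List.prod_cons, mul_assoc], by rw [List.foldl_cons, cmul_kctx]; exact h2⟩

/-- **The Lagrange factor fold is the Lagrange basis value**: for a duplicate-free reduced node list
`Hl` with node set `H = elt '' Hl`, a node `a ∈ Hl` and reduced `t`,
`elt (lagEvalL …) = (Lagrange.basis H id (elt a)).eval (elt t)`. [cite: Umans2003, §4.1, eq. (2)] -/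
theorem elt_lagEvalL {Hl : List ℕ} (hHl : ∀ x ∈ Hl, x < 2 ^ (M + 1)) (hnd : Hl.Nodup) {a : ℕ} (ha : a ∈ Hl) {t : ℕ} (ht : t < 2 ^ (M + 1)) :
    GF2.elt M (lagEvalL (kctx M) Hl a t) = (Lagrange.basis ((Hl.map (GF2.elt M)).toFinset) id (GF2.elt M a)).eval (GF2.elt M t) ∧
      lagEvalL (kctx M) Hl a t < 2 ^ (M + 1) := by
  classical
  haveI : CharP (GF2 M) 2 := GF2.charP M
  set f : ℕ → ℕ := fun a' => cmul (kctx M) (xorW (M + 2) t a') (cinv (kctx M) (xorW (M + 2) a a')) with hf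
  have haa : a < 2 ^ (M + 1) := hHl a ha
  -- the factor for a node `a' ≠ a`
  have hfac : ∀ a' ∈ Hl, a' ≠ a → GF2.elt M (f a') = (GF2.elt M a - GF2.elt M a')⁻¹ * (GF2.elt M t - GF2.elt M a') ∧ f a' < 2 ^ (M + 1) := by
    intro a' ha' hne
    obtain ⟨e1, e1lt⟩ := elt_xorW M (W := M + 2) (by omega) ht (hHl a' ha')
    obtain ⟨e2, e2lt⟩ := elt_xorW M (W := M + 2) (by omega) haa (hHl a' ha')
    have hne0 : GF2.elt M (xorW (M + 2) a a') ≠ 0 := by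
      rw [e2, ← CharTwo.sub_eq_add, sub_ne_zero]
      exact fun h => hne (GF2.elt_injective (hHl a' ha') haa h.symm)
    obtain ⟨e3, e3lt⟩ := kinv_spec M e2lt hne0
    obtain ⟨e4, e4lt⟩ := kmul_spec M e1lt e3lt
    refine ⟨?_, e4lt⟩
    rw [hf]; simp only []
    rw [cmul_kctx, cinv_kctx, e4, e3, e1, e2, ← CharTwo.sub_eq_add, ← CharTwo.sub_eq_add, mul_comm]
  -- a bounded variant of `f` for the fold lemma (values outside are irrelevant)
  have hfall : ∀ a', f a' < 2 ^ (M + 1) ∨ True := fun _ => Or.inr trivial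
  have hflt : ∀ a' ∈ Hl.filter (fun a' => a' != a), f a' < 2 ^ (M + 1) := fun a' ha' => by
    obtain ⟨h1, h2⟩ := List.mem_filter.1 ha'
    exact (hfac a' h1 (by simpa using h2)).2
  -- the fold over the attached list
  have key : ∀ (l : List ℕ), (∀ a' ∈ l, f a' < 2 ^ (M + 1)) → ∀ acc, acc < 2 ^ (M + 1) →
      GF2.elt M (l.foldl (fun acc a' => cmul (kctx M) acc (f a')) acc) = GF2.elt M acc * (l.map fun a' => GF2.elt M (f a')).prod ∧
        l.foldl (fun acc a' => cmul (kctx M) acc (f a')) acc < 2 ^ (M + 1) := by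
    intro l hl
    induction l with
    | nil => intro acc hacc; exact ⟨by simp, hacc⟩
    | cons i l ih =>
      intro acc hacc
      obtain ⟨hm, hmlt⟩ := kmul_spec M hacc (hl i List.mem_cons_self)
      obtain ⟨h1, h2⟩ := ih (fun x hx => hl x (List.mem_cons_of_mem i hx)) _ hmlt
      exact ⟨by rw [List.foldl_cons, cmul_kctx, h1, hm, List.map_cons, List.prod_cons, mul_assoc], by rw [List.foldl_cons, cmul_kctx]; exact h2⟩
  obtain ⟨hval, hlt⟩ := key _ hflt 1 (Nat.one_lt_two_pow (by omega))
  refine ⟨?_, by rw [lagEvalL]; exact hlt⟩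
  rw [lagEvalL, show (kctx M).1 = M + 2 from rfl]
  change GF2.elt M ((Hl.filter fun a' => a' != a).foldl (fun acc a' => cmul (kctx M) acc (f a')) 1) = _
  rw [hval, GF2.elt, bitsPoly_one, map_one, one_mul, Lagrange.basis, eval_prod]
  -- the list product over `Hl ∖ {a}` against the finset product over `H.erase (elt a)`
  have hinj : ∀ x ∈ Hl, ∀ y ∈ Hl, GF2.elt M x = GF2.elt M y → x = y := fun x hx y hy h => GF2.elt_injective (hHl x hx) (hHl y hy) h
  have hset : ((Hl.map (GF2.elt M)).toFinset).erase (GF2.elt M a) = ((Hl.filter fun a' => a' != a).map (GF2.elt M)).toFinset := by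
    ext z
    simp only [Finset.mem_erase, List.mem_toFinset, List.mem_map, List.mem_filter, bne_iff_ne, ne_eq]
    constructor
    · rintro ⟨hz, x, hx, rfl⟩; exact ⟨x, ⟨hx, fun h => hz (by rw [h])⟩, rfl⟩
    · rintro ⟨x, ⟨hx, hxa⟩, rfl⟩; exact ⟨fun h => hxa (hinj x hx a ha h), x, hx, rfl⟩
  have hnd' : ((Hl.filter fun a' => a' != a).map (GF2.elt M)).Nodup :=
    (List.nodup_map_iff_inj_on (hnd.filter _)).2 fun x hx y hy h => hinj x (List.mem_of_mem_filter hx) y (List.mem_of_mem_filter hy) h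
  rw [hset, List.prod_toFinset _ hnd', List.map_map]
  refine congrArg List.prod (List.map_congr_left fun a' ha' => ?_)
  obtain ⟨h1, h2⟩ := List.mem_filter.1 ha'
  rw [Function.comp_apply, (hfac a' h1 (by simpa using h2)).1, Lagrange.basisDivisor, eval_mul, eval_C, eval_sub, eval_X, eval_C, id, id]

/-- **The term fold is the product of the Lagrange values** over the coordinates. [cite: Umans2003, §4.1, eq. (2)] -/
theorem elt_ldeTermL {Hl : List ℕ} (hHl : ∀ x ∈ Hl, x < 2 ^ (M + 1)) (hnd : Hl.Nodup) {d : ℕ} {pos u : List ℕ} (hpos : LRep M d pos)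
    (hposH : ∀ x ∈ pos, x ∈ Hl) (hu : LRep M d u) :
    GF2.elt M (ldeTermL (kctx M) Hl pos u) =
        ∏ j : Fin d, (Lagrange.basis ((Hl.map (GF2.elt M)).toFinset) id (GF2.elt M (pos.getD j 0))).eval (GF2.elt M (u.getD j 0)) ∧
      ldeTermL (kctx M) Hl pos u < 2 ^ (M + 1) := by
  have hposj : ∀ j, j < d → pos.getD j 0 ∈ Hl := fun j hj => by
    rw [List.getD_eq_getElem _ _ (by rw [hpos.1]; exact hj)]; exact hposH _ (List.getElem_mem _)
  set f : ℕ → ℕ := fun j => lagEvalL (kctx M) Hl (pos.getD j 0) (u.getD j 0) with hf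
  have key : ∀ (l : List ℕ), (∀ j ∈ l, j < d) → ∀ acc, acc < 2 ^ (M + 1) →
      GF2.elt M (l.foldl (fun acc j => cmul (kctx M) acc (f j)) acc) = GF2.elt M acc * (l.map fun j => GF2.elt M (f j)).prod ∧
        l.foldl (fun acc j => cmul (kctx M) acc (f j)) acc < 2 ^ (M + 1) := by
    intro l hl
    induction l with
    | nil => intro acc hacc; exact ⟨by simp, hacc⟩
    | cons i l ih =>
      intro acc hacc
      have hfi : f i < 2 ^ (M + 1) := (elt_lagEvalL hHl hnd (hposj i (hl i List.mem_cons_self)) (hu.getD_lt i)).2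
      obtain ⟨hm, hmlt⟩ := kmul_spec M hacc hfi
      obtain ⟨h1, h2⟩ := ih (fun x hx => hl x (List.mem_cons_of_mem i hx)) _ hmlt
      exact ⟨by rw [List.foldl_cons, cmul_kctx, h1, hm, List.map_cons, List.prod_cons, mul_assoc], by rw [List.foldl_cons, cmul_kctx]; exact h2⟩
  obtain ⟨hval, hlt⟩ := key (List.range pos.length) (fun j hj => by rw [← hpos.1]; exact List.mem_range.1 hj) 1 (Nat.one_lt_two_pow (by omega))
  refine ⟨?_, by rw [ldeTermL]; exact hlt⟩
  rw [ldeTermL, hval, GF2.elt, bitsPoly_one, map_one, one_mul, hpos.1, prod_map_range_fin]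
  refine Finset.prod_congr rfl fun j _ => ?_
  exact (elt_lagEvalL hHl hnd (hposj j j.2) (hu.getD_lt j)).1

/-- **The extension fold is the sum over the set positions.** [cite: Umans2003, §4.1, eq. (2), Thm. 8] -/
theorem elt_ldeEvalL {Hl : List ℕ} (hHl : ∀ x ∈ Hl, x < 2 ^ (M + 1)) (hnd : Hl.Nodup) {d n : ℕ} {posL : List (List ℕ)} (hn : posL.length = n)
    (hpos : ∀ k, (hk : k < n) → LRep M d (posL.getD k []) ∧ ∀ x ∈ posL.getD k [], x ∈ Hl) (xs : List Bool) {u : List ℕ} (hu : LRep M d u) :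
    GF2.elt M (ldeEvalL (kctx M) Hl posL xs u) =
        ∑ k : Fin n, (if xs.getD k false then
          ∏ j : Fin d, (Lagrange.basis ((Hl.map (GF2.elt M)).toFinset) id (GF2.elt M ((posL.getD k []).getD j 0))).eval (GF2.elt M (u.getD j 0)) else 0) ∧
      ldeEvalL (kctx M) Hl posL xs u < 2 ^ (M + 1) := by
  set g : ℕ → ℕ := fun k => ldeTermL (kctx M) Hl (posL.getD k []) u with hg
  have key : ∀ (l : List ℕ), (∀ k ∈ l, k < n) → ∀ acc, acc < 2 ^ (M + 1) →
      GF2.elt M (l.foldl (fun acc k => if xs.getD k false then xorW (M + 2) acc (g k) else acc) acc) =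
          GF2.elt M acc + (l.map fun k => if xs.getD k false then GF2.elt M (g k) else 0).sum ∧
        l.foldl (fun acc k => if xs.getD k false then xorW (M + 2) acc (g k) else acc) acc < 2 ^ (M + 1) := by
    intro l hl
    induction l with
    | nil => intro acc hacc; exact ⟨by simp, hacc⟩
    | cons k l ih =>
      intro acc hacc
      have hgk : g k < 2 ^ (M + 1) := (elt_ldeTermL hHl hnd (hpos k (hl k List.mem_cons_self)).1 (hpos k (hl k List.mem_cons_self)).2 hu).2
      rw [List.foldl_cons, List.map_cons, List.sum_cons]
      split_ifs with hb
      · obtain ⟨hx, hxlt⟩ := elt_xorW M (W := M + 2) (by omega) hacc hgk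
        obtain ⟨h1, h2⟩ := ih (fun x hx => hl x (List.mem_cons_of_mem k hx)) _ hxlt
        exact ⟨by rw [h1, hx, add_assoc], h2⟩
      · obtain ⟨h1, h2⟩ := ih (fun x hx => hl x (List.mem_cons_of_mem k hx)) _ hacc
        exact ⟨by rw [h1, zero_add], h2⟩
  obtain ⟨hval, hlt⟩ := key (List.range posL.length) (fun k hk => by rw [← hn]; exact List.mem_range.1 hk) 0 (Nat.two_pow_pos _)
  refine ⟨?_, by rw [ldeEvalL]; exact hlt⟩
  rw [ldeEvalL, show (kctx M).1 = M + 2 from rfl, hval, GF2.elt, bitsPoly_zero, map_zero, zero_add, hn, sum_map_range_fin]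
  refine Finset.sum_congr rfl fun k _ => ?_
  split_ifs with hb
  · exact (elt_ldeTermL hHl hnd (hpos k k.2).1 (hpos k k.2).2 hu).1
  · rfl

/-- **The augmented encoding fold has the stated value** `Σ_{j<d} φ(u^{q^{d-j}}) · β^{q^j}`
(`q = 2^{logq}`, `φ = elt ∘ ldeEvalL` on the representative list). [cite: Umans2003, §4.2, Def. 9] -/
theorem lElt_augEvalL {d : ℕ} {pc : List ℕ} (hpc : LRep M d pc) (hd : 1 ≤ d) (logq : ℕ) {Hl : List ℕ} (hHl : ∀ x ∈ Hl, x < 2 ^ (M + 1))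
    (hnd : Hl.Nodup) {n : ℕ} {posL : List (List ℕ)} (hn : posL.length = n)
    (hpos : ∀ k, (hk : k < n) → LRep M d (posL.getD k []) ∧ ∀ x ∈ posL.getD k [], x ∈ Hl) (xs : List Bool)
    {βu u : List ℕ} (hβ : LRep M d βu) (hu : LRep M d u) :
    LRep M d (augEvalL (kctx M) pc logq Hl posL xs βu u) ∧
      lElt M pc (augEvalL (kctx M) pc logq Hl posL xs βu u) =
        ∑ j : Fin d, AdjoinRoot.of (pOf M pc) (GF2.elt M (ldeEvalL (kctx M) Hl posL xs (lsqIter (kctx M) pc u (logq * (d - j))))) *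
          lElt M pc βu ^ (2 ^ (logq * j)) := by
  set term : ℕ → List ℕ := fun j =>
    lsmul (kctx M) (ldeEvalL (kctx M) Hl posL xs (lsqIter (kctx M) pc u (logq * (d - j)))) (lsqIter (kctx M) pc βu (logq * j)) with hterm
  set tval : ℕ → AdjoinRoot (pOf M pc) := fun j =>
    AdjoinRoot.of (pOf M pc) (GF2.elt M (ldeEvalL (kctx M) Hl posL xs (lsqIter (kctx M) pc u (logq * (d - j))))) * lElt M pc βu ^ (2 ^ (logq * j)) with htval
  have htermok : ∀ j, LRep M d (term j) ∧ lElt M pc (term j) = tval j := fun j => by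
    obtain ⟨hs1, hs2⟩ := lsqIter_spec M hpc hd hu (logq * (d - j))
    obtain ⟨hb1, hb2⟩ := lsqIter_spec M hpc hd hβ (logq * j)
    have hφlt := (elt_ldeEvalL hHl hnd hn hpos xs hs1).2
    obtain ⟨h1, h2⟩ := lsmul_spec M hφlt hb1
    refine ⟨h1, ?_⟩
    rw [hterm, htval]; simp only []
    rw [lElt, h2, map_mul, AdjoinRoot.mk_C, ← lElt, hb2]
  have key : ∀ (l : List ℕ) (acc : List ℕ), LRep M d acc →
      LRep M d (l.foldl (fun acc j => ladd (M + 2) acc (term j)) acc) ∧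
        lElt M pc (l.foldl (fun acc j => ladd (M + 2) acc (term j)) acc) = lElt M pc acc + (l.map tval).sum := by
    intro l
    induction l with
    | nil => intro acc hacc; exact ⟨hacc, by simp⟩
    | cons j l ih =>
      intro acc hacc
      obtain ⟨ha1, ha2⟩ := ladd_spec M hacc (htermok j).1
      obtain ⟨h1, h2⟩ := ih _ ha1
      refine ⟨by rw [List.foldl_cons]; exact h1, ?_⟩
      rw [List.foldl_cons, h2, lElt, ha2, map_add, ← lElt, ← lElt, (htermok j).2, List.map_cons, List.sum_cons, add_assoc]
  have h0 : LRep M d (List.replicate pc.length 0) := ⟨by rw [List.length_replicate, hpc.1], fun x hx => by rw [List.eq_of_mem_replicate hx]; exact Nat.two_pow_pos _⟩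
  obtain ⟨h1, h2⟩ := key (List.range pc.length) _ h0
  have hfold : augEvalL (kctx M) pc logq Hl posL xs βu u = (List.range pc.length).foldl (fun acc j => ladd (M + 2) acc (term j)) (List.replicate pc.length 0) := by
    rw [augEvalL, hpc.1]; rfl
  rw [hfold]
  refine ⟨h1, ?_⟩
  rw [h2, lElt, polyOfList_replicate_zero, map_zero, zero_add, hpc.1, sum_map_range_fin]

/-- **The positions fold lists the powers `γ⁰, …, γ^{n-1}`** as reduced representatives.
[cite: Umans2003, §4.1 ("we embed `x_i` at location `α^{ri}`")] -/
theorem positionsL_spec {d : ℕ} {pc : List ℕ} (hpc : LRep M d pc) (hd : 1 ≤ d) {γu : List ℕ} (hγ : LRep M d γu) (n : ℕ) :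
    (positionsL (kctx M) pc γu n).length = n ∧
      ∀ k, (hk : k < n) → LRep M d ((positionsL (kctx M) pc γu n).getD k []) ∧ lElt M pc ((positionsL (kctx M) pc γu n).getD k []) = lElt M pc γu ^ k := by
  have inv : ∀ j : ℕ, let st := (List.replicate j ()).foldl (fun st _ => (lmul (kctx M) pc st.1 γu, st.2 ++ [st.1])) (lone pc.length, ([] : List (List ℕ)))
      LRep M d st.1 ∧ lElt M pc st.1 = lElt M pc γu ^ j ∧ st.2.length = j ∧
        ∀ k, (hk : k < j) → LRep M d (st.2.getD k []) ∧ lElt M pc (st.2.getD k []) = lElt M pc γu ^ k := by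
    intro j
    induction j with
    | zero =>
      obtain ⟨h1, h2⟩ := lone_spec M hpc hd
      rw [hpc.1]
      simp only [List.replicate_zero, List.foldl_nil]
      exact ⟨h1, by rw [h2, pow_zero], rfl, fun k hk => absurd hk (Nat.not_lt_zero k)⟩
    | succ j ih =>
      obtain ⟨ih1, ih2, ih3, ih4⟩ := ih
      simp only [List.replicate_succ', List.foldl_append, List.foldl_cons, List.foldl_nil]
      set st := (List.replicate j ()).foldl (fun st _ => (lmul (kctx M) pc st.1 γu, st.2 ++ [st.1])) (lone pc.length, ([] : List (List ℕ)))
      obtain ⟨hm1, hm2⟩ := lmul_spec M hpc hd ih1 hγ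
      refine ⟨hm1, by rw [hm2, ih2, pow_succ], by rw [List.length_append, List.length_singleton, ih3], fun k hk => ?_⟩
      rcases Nat.lt_or_ge k j with hlt | hge
      · rw [List.getD_append _ _ _ _ (by rw [ih3]; exact hlt)]; exact ih4 k hlt
      · have hkj : k = j := by omega
        subst hkj
        rw [List.getD_append_right _ _ _ _ (by rw [ih3]), ih3, Nat.sub_self, List.getD_cons_zero]
        exact ⟨ih1, ih2⟩
  obtain ⟨-, -, h3, h4⟩ := inv n
  exact ⟨h3, h4⟩

/-- The orbit lists `α^{i+1} y`. [cite: Umans2003, §5, eq. (7)] -/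
def orbitL (c : ℕ × ℕ × ℕ) (pc αu yu : List ℕ) (i : ℕ) : List ℕ := Nat.iterate (fun w => lmul c pc αu w) (i + 1) yu

/-- The orbit lists represent `α^{i+1} y`. [cite: Umans2003, §5, eq. (7)] -/
theorem orbitL_spec {d : ℕ} {pc : List ℕ} (hpc : LRep M d pc) (hd : 1 ≤ d) {αu yu : List ℕ} (hα : LRep M d αu) (hy : LRep M d yu) :
    ∀ i : ℕ, LRep M d (orbitL (kctx M) pc αu yu i) ∧ lElt M pc (orbitL (kctx M) pc αu yu i) = lElt M pc αu ^ (i + 1) * lElt M pc yu := by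
  have key : ∀ i : ℕ, LRep M d (Nat.iterate (fun w => lmul (kctx M) pc αu w) i yu) ∧
      lElt M pc (Nat.iterate (fun w => lmul (kctx M) pc αu w) i yu) = lElt M pc αu ^ i * lElt M pc yu := by
    intro i
    induction i with
    | zero => exact ⟨hy, by rw [Function.iterate_zero, id, pow_zero, one_mul]⟩
    | succ i ih =>
      rw [Function.iterate_succ', Function.comp_apply]
      obtain ⟨h1, h2⟩ := lmul_spec M hpc hd hα ih.1
      exact ⟨h1, by rw [h2, ih.2, pow_succ]; ring⟩
  intro i
  exact key (i + 1)

/-- **The symbol fold lists `Ẽ` along the orbit**: entry `i` is the augmented encoding of the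
representative of `α^{i+1} y`. [cite: Umans2003, §5, Thm. 14, eq. (7)] -/
theorem symbolsL_spec (c : ℕ × ℕ × ℕ) (pc : List ℕ) (logq : ℕ) (Hl : List ℕ) (posL : List (List ℕ)) (xs : List Bool) (βu αu yu : List ℕ) (m : ℕ) :
    (symbolsL c pc logq Hl posL xs βu αu yu m).length = m ∧
      ∀ i, (hi : i < m) → (symbolsL c pc logq Hl posL xs βu αu yu m).getD i [] = augEvalL c pc logq Hl posL xs βu (orbitL c pc αu yu i) := by
  have inv : ∀ j : ℕ, let st := (List.replicate j ()).foldl (fun st _ =>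
        (lmul c pc αu st.1, st.2 ++ [augEvalL c pc logq Hl posL xs βu (lmul c pc αu st.1)])) (yu, ([] : List (List ℕ)))
      st.1 = Nat.iterate (fun w => lmul c pc αu w) j yu ∧ st.2.length = j ∧
        ∀ i, (hi : i < j) → st.2.getD i [] = augEvalL c pc logq Hl posL xs βu (orbitL c pc αu yu i) := by
    intro j
    induction j with
    | zero => exact ⟨rfl, rfl, fun i hi => absurd hi (Nat.not_lt_zero i)⟩
    | succ j ih =>
      obtain ⟨ih1, ih2, ih3⟩ := ih
      simp only [List.replicate_succ', List.foldl_append, List.foldl_cons, List.foldl_nil]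
      set st := (List.replicate j ()).foldl (fun st _ =>
        (lmul c pc αu st.1, st.2 ++ [augEvalL c pc logq Hl posL xs βu (lmul c pc αu st.1)])) (yu, ([] : List (List ℕ)))
      refine ⟨by rw [ih1, Function.iterate_succ', Function.comp_apply], by rw [List.length_append, List.length_singleton, ih2], fun i hi => ?_⟩
      rcases Nat.lt_or_ge i j with hlt | hge
      · rw [List.getD_append _ _ _ _ (by rw [ih2]; exact hlt)]; exact ih3 i hlt
      · have hij : i = j := by omega
        subst hij
        rw [List.getD_append_right _ _ _ _ (by rw [ih2]), ih2, Nat.sub_self, List.getD_cons_zero, ih1, orbitL, Function.iterate_succ',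
          Function.comp_apply]
  obtain ⟨-, h2, h3⟩ := inv m
  exact ⟨h2, h3⟩

/-- The output bits: length and entries. [cite: Umans2003, Lemma 13] -/
theorem genBitsL_spec (c : ℕ × ℕ × ℕ) (b : ℕ) (symbols : List (List ℕ)) (a yv : ℕ) :
    (genBitsL c b symbols a yv).length = symbols.length ∧
      ∀ i, (hi : i < symbols.length) → (genBitsL c b symbols a yv).getD i false = hadB b (keval c (symbols.getD i []) a) yv := by
  refine ⟨by rw [genBitsL, List.length_map], fun i hi => ?_⟩
  rw [genBitsL, List.getD_eq_getElem _ _ (by rw [List.length_map]; exact hi), List.getElem_map, List.getD_eq_getElem _ _ hi]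

/-- Parsing: `k` numbers below `2^b`. [folklore] -/
theorem parseL_spec (b k : ℕ) (w : List Bool) : (parseL b k w).length = k ∧ ∀ x ∈ parseL b k w, x < 2 ^ b := by
  refine ⟨by rw [parseL, List.length_map, List.length_range], fun x hx => ?_⟩
  obtain ⟨i, -, rfl⟩ := List.mem_map.1 hx
  refine (bitsToNat_lt _).trans_le (Nat.pow_le_pow_right (by norm_num) ?_)
  rw [List.length_take]; exact min_le_left _ _

/-- Parsing aligned blocks: entry `i` is the value of bits `[i b, (i+1) b)`. [folklore] -/
theorem parseL_getD (b k : ℕ) (w : List Bool) {i : ℕ} (hi : i < k) : (parseL b k w).getD i 0 = bitsToNat ((w.drop (i * b)).take b) := by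
  rw [parseL, List.getD_eq_getElem _ _ (by rw [List.length_map, List.length_range]; exact hi), List.getElem_map, List.getElem_range]

end EvalSpec

end UmansFP

end Literature.Computability.Complexity

end
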